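import Summits.Ventures.Crystal3D.Theorems.StickyWulffConstantGenericWallFloorSteering
import HarnessLib

/-!
# Steering lemma, twin dozen — core case «U»

HONEST FRAMING. Venture `Summits/Ventures/Crystal3D` (cell `crystal3d-full`), helper for the crux
`GenericWallFloor` (stmt-Ventures-19480) of `route-Ventures-StickyWulffConstant`, REGISTERED line `WallLedgerG`,
open stub `stub_twoSlabAdhesion` (general fillings; ARCH v4 «coherent walks in tubes», lemma (S), twin dozen).
Rung credit only; F-C1 not moved.

FRAME-FREE SETTING.  `ℓ₁, ℓ₂, ℓ₃` unit vectors at pairwise inner product `1/2` with `⟪ℓᵢ, n⟫ = −√(2/3)` for a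
unit `n` (the near-polar triple of a twin dozen), mirrors `mᵢ = ℓᵢ + 2√(2/3) n`, hexagon `±(ℓᵢ − ℓⱼ)`: the twelve
vectors `T = {ℓᵢ, mᵢ, ±(ℓᵢ − ℓⱼ)}` are the twin dozen (anticuboctahedron).  For orthonormal-ish `z, q`
(only `‖z‖ = 1` is used) and the steep element `u` of type «U» (`u = m₁ = ℓ₁ + 2√(2/3) n`, mirror) with
`⟪u, z⟫ + ⟪u, q⟫ ≥ 1`, `⟪u, q⟫ < 1/32`, and a `q`-steep element `v ∈ T` (`⟪v, q⟫ ≥ √2/2`), some `d ∈ T` has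
`⟪d, z⟫ ≥ 1/32` and `⟪d, q⟫ ≥ 1/32`.  Explicit case analysis over the twelve positions of `v` (the values
`⟪v, u⟫ ∈ {1, ½, 0, −½, −1, −1/3, −5/6}` decide: `v` itself is excluded by `⟪v, z⟫ > ⟪v, u⟫ − 1/4`; otherwise
`u + v`, a common-neighbour pair, or a hexagon neighbour of `u` works).  Assembled with the other two cores and
the steep-element lemma in `…SteeringTwin`; kit j292269 certifies the sharp constant `0.14` numerically.
WHAT THIS IS NOT: not the stub; F-C1 not moved.
-/

noncomputable section

namespace Summit.Ventures.Crystal3D.Theorems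

open scoped InnerProductSpace

set_option linter.unusedSimpArgs false in
set_option maxHeartbeats 800000 in
/-- Twin-dozen steering, core case «U» (one `maxHeartbeats` bump: twelve explicit sub-cases in one
declaration). -/
theorem anticubo_steer_U {{ℓ₁ ℓ₂ ℓ₃ n z q v : EuclideanSpace ℝ (Fin 3)}}
    (h1 : ‖ℓ₁‖ = 1) (h2 : ‖ℓ₂‖ = 1) (h3 : ‖ℓ₃‖ = 1)
    (p12 : ⟪ℓ₁, ℓ₂⟫_ℝ = 1 / 2) (p13 : ⟪ℓ₁, ℓ₃⟫_ℝ = 1 / 2) (p23 : ⟪ℓ₂, ℓ₃⟫_ℝ = 1 / 2)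
    (hn : ‖n‖ = 1) (n1 : ⟪ℓ₁, n⟫_ℝ = -Real.sqrt (2 / 3)) (n2 : ⟪ℓ₂, n⟫_ℝ = -Real.sqrt (2 / 3))
    (n3 : ⟪ℓ₃, n⟫_ℝ = -Real.sqrt (2 / 3)) (hz : ‖z‖ = 1)
    (hsum : 1 ≤ ⟪ℓ₁ + (2 * Real.sqrt (2 / 3)) • n, z⟫_ℝ + ⟪ℓ₁ + (2 * Real.sqrt (2 / 3)) • n, q⟫_ℝ) (hb : ⟪ℓ₁ + (2 * Real.sqrt (2 / 3)) • n, q⟫_ℝ < 1 / 32)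
    (hv : (v = ℓ₁ ∨ v = ℓ₂ ∨ v = ℓ₃ ∨ v = ℓ₁ + (2 * Real.sqrt (2 / 3)) • n ∨ v = ℓ₂ + (2 * Real.sqrt (2 / 3)) • n ∨
      v = ℓ₃ + (2 * Real.sqrt (2 / 3)) • n ∨ v = ℓ₁ - ℓ₂ ∨ v = ℓ₂ - ℓ₁ ∨ v = ℓ₁ - ℓ₃ ∨ v = ℓ₃ - ℓ₁ ∨ v = ℓ₂ - ℓ₃ ∨ v = ℓ₃ - ℓ₂))
    (hβ : Real.sqrt 2 / 2 ≤ ⟪v, q⟫_ℝ) :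
    ∃ d : EuclideanSpace ℝ (Fin 3), (d = ℓ₁ ∨ d = ℓ₂ ∨ d = ℓ₃ ∨ d = ℓ₁ + (2 * Real.sqrt (2 / 3)) • n ∨ d = ℓ₂ + (2 * Real.sqrt (2 / 3)) • n ∨
      d = ℓ₃ + (2 * Real.sqrt (2 / 3)) • n ∨ d = ℓ₁ - ℓ₂ ∨ d = ℓ₂ - ℓ₁ ∨ d = ℓ₁ - ℓ₃ ∨ d = ℓ₃ - ℓ₁ ∨ d = ℓ₂ - ℓ₃ ∨ d = ℓ₃ - ℓ₂) ∧
      (1 / 32 : ℝ) ≤ ⟪d, z⟫_ℝ ∧ (1 / 32 : ℝ) ≤ ⟪d, q⟫_ℝ := by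
  -- numerics
  set r : ℝ := Real.sqrt (2 / 3) with hr
  have hr2 : r * r = 2 / 3 := by rw [hr]; exact Real.mul_self_sqrt (by norm_num)
  have hrpos : 0 < r := by rw [hr]; positivity
  have h14 : (1.4 : ℝ) < Real.sqrt 2 := by
    rw [show (1.4 : ℝ) = Real.sqrt (1.4 ^ 2) by rw [Real.sqrt_sq (by norm_num)]]
    exact Real.sqrt_lt_sqrt (by norm_num) (by norm_num)
  -- the product table
  have l11 : ⟪ℓ₁, ℓ₁⟫_ℝ = 1 := by rw [real_inner_self_eq_norm_sq, h1, one_pow]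
  have l22 : ⟪ℓ₂, ℓ₂⟫_ℝ = 1 := by rw [real_inner_self_eq_norm_sq, h2, one_pow]
  have l33 : ⟪ℓ₃, ℓ₃⟫_ℝ = 1 := by rw [real_inner_self_eq_norm_sq, h3, one_pow]
  have nn : ⟪n, n⟫_ℝ = 1 := by rw [real_inner_self_eq_norm_sq, hn, one_pow]
  have p21 : ⟪ℓ₂, ℓ₁⟫_ℝ = 1 / 2 := by rw [real_inner_comm, p12]
  have p31 : ⟪ℓ₃, ℓ₁⟫_ℝ = 1 / 2 := by rw [real_inner_comm, p13]
  have p32 : ⟪ℓ₃, ℓ₂⟫_ℝ = 1 / 2 := by rw [real_inner_comm, p23]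
  have n1' : ⟪n, ℓ₁⟫_ℝ = -r := by rw [real_inner_comm, n1]
  have n2' : ⟪n, ℓ₂⟫_ℝ = -r := by rw [real_inner_comm, n2]
  have n3' : ⟪n, ℓ₃⟫_ℝ = -r := by rw [real_inner_comm, n3]
  set m₁ : EuclideanSpace ℝ (Fin 3) := ℓ₁ + (2 * r) • n with hm1
  set m₂ : EuclideanSpace ℝ (Fin 3) := ℓ₂ + (2 * r) • n with hm2
  set m₃ : EuclideanSpace ℝ (Fin 3) := ℓ₃ + (2 * r) • n with hm3
  -- mirrors against arbitrary vectors: `⟪mᵢ, x⟫ = ⟪ℓᵢ, x⟫ + 2r⟪n, x⟫`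
  have mx1 : ∀ x, ⟪m₁, x⟫_ℝ = ⟪ℓ₁, x⟫_ℝ + 2 * r * ⟪n, x⟫_ℝ := fun x => by
    rw [hm1, inner_add_left, inner_smul_left, conj_trivial]
  have mx2 : ∀ x, ⟪m₂, x⟫_ℝ = ⟪ℓ₂, x⟫_ℝ + 2 * r * ⟪n, x⟫_ℝ := fun x => by
    rw [hm2, inner_add_left, inner_smul_left, conj_trivial]
  have mx3 : ∀ x, ⟪m₃, x⟫_ℝ = ⟪ℓ₃, x⟫_ℝ + 2 * r * ⟪n, x⟫_ℝ := fun x => by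
    rw [hm3, inner_add_left, inner_smul_left, conj_trivial]
  have xm1 : ∀ x, ⟪x, m₁⟫_ℝ = ⟪x, ℓ₁⟫_ℝ + 2 * r * ⟪x, n⟫_ℝ := fun x => by
    rw [real_inner_comm, mx1, real_inner_comm ℓ₁, real_inner_comm n]
  have xm2 : ∀ x, ⟪x, m₂⟫_ℝ = ⟪x, ℓ₂⟫_ℝ + 2 * r * ⟪x, n⟫_ℝ := fun x => by
    rw [real_inner_comm, mx2, real_inner_comm ℓ₂, real_inner_comm n]
  have xm3 : ∀ x, ⟪x, m₃⟫_ℝ = ⟪x, ℓ₃⟫_ℝ + 2 * r * ⟪x, n⟫_ℝ := fun x => by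
    rw [real_inner_comm, mx3, real_inner_comm ℓ₃, real_inner_comm n]
  -- norms of the twelve
  have nm1 : ‖m₁‖ = 1 := by
    have : ‖m₁‖ ^ 2 = 1 := by
      rw [← real_inner_self_eq_norm_sq, mx1, xm1, xm1, l11, n1', n1, nn]; linear_combination (0 : ℝ) * hr2
    exact (pow_eq_one_iff_of_nonneg (norm_nonneg _) two_ne_zero).1 this
  have nm2 : ‖m₂‖ = 1 := by
    have : ‖m₂‖ ^ 2 = 1 := by
      rw [← real_inner_self_eq_norm_sq, mx2, xm2, xm2, l22, n2', n2, nn]; linear_combination (0 : ℝ) * hr2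
    exact (pow_eq_one_iff_of_nonneg (norm_nonneg _) two_ne_zero).1 this
  have nm3 : ‖m₃‖ = 1 := by
    have : ‖m₃‖ ^ 2 = 1 := by
      rw [← real_inner_self_eq_norm_sq, mx3, xm3, xm3, l33, n3', n3, nn]; linear_combination (0 : ℝ) * hr2
    exact (pow_eq_one_iff_of_nonneg (norm_nonneg _) two_ne_zero).1 this
  have nd : ∀ {a b : EuclideanSpace ℝ (Fin 3)}, ‖a‖ = 1 → ‖b‖ = 1 → ⟪a, b⟫_ℝ = 1 / 2 → ‖a - b‖ = 1 := by
    intro a b ha hb hab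
    have : ‖a - b‖ ^ 2 = 1 := by rw [norm_sub_sq_real, ha, hb, hab]; norm_num
    exact (pow_eq_one_iff_of_nonneg (norm_nonneg _) two_ne_zero).1 this
  have d12 := nd h1 h2 p12
  have d21 := nd h2 h1 p21
  have d13 := nd h1 h3 p13
  have d31 := nd h3 h1 p31
  have d23 := nd h2 h3 p23
  have d32 := nd h3 h2 p32
  -- the sum rule `⟪ℓ₁,x⟫ + ⟪ℓ₂,x⟫ + ⟪ℓ₃,x⟫ = −3r⟪n,x⟫`
  have hsumvec : ℓ₁ + ℓ₂ + ℓ₃ = Real.sqrt 6 • (-n) :=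
    sum_eq_sqrt_six_smul ℓ₁ ℓ₂ ℓ₃ (-n) h1 h2 h3 (by rw [norm_neg, hn]) p12 p13 p23
      (by rw [inner_neg_right, n1, neg_neg]) (by rw [inner_neg_right, n2, neg_neg]) (by rw [inner_neg_right, n3, neg_neg])
  have h63 : Real.sqrt 6 = 3 * r := by
    rw [hr, show (6 : ℝ) = 3 ^ 2 * (2 / 3) by norm_num, Real.sqrt_mul (by norm_num), Real.sqrt_sq (by norm_num)]
  have sumx : ∀ x, ⟪ℓ₁, x⟫_ℝ + ⟪ℓ₂, x⟫_ℝ + ⟪ℓ₃, x⟫_ℝ = -(3 * r * ⟪n, x⟫_ℝ) := fun x => by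
    rw [← inner_add_left, ← inner_add_left, hsumvec, inner_smul_left, inner_neg_left, conj_trivial, h63]; ring
  have isl : ∀ a b c : EuclideanSpace ℝ (Fin 3), ⟪a - b, c⟫_ℝ = ⟪a, c⟫_ℝ - ⟪b, c⟫_ℝ := fun a b c =>
    inner_sub_left a b c
  clear_value r m₁ m₂ m₃
  clear hm1 hm2 hm3 hr hsumvec h63
  -- `u` is within 1/4 of `z`; every unit `x` has `⟪x, z⟫ > ⟪x, u⟫ − 1/4`
  have hU1 : ‖(m₁)‖ = 1 := nm1
  have ha1 : ⟪m₁, z⟫_ℝ ≤ 1 := by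
    have := abs_real_inner_le_norm (m₁) z; rw [hU1, hz, one_mul] at this; exact (abs_le.1 this).2
  have hb0 : 0 ≤ ⟪m₁, q⟫_ℝ := by linarith
  have near : ∀ x : EuclideanSpace ℝ (Fin 3), ‖x‖ = 1 → ⟪x, m₁⟫_ℝ - 1 / 4 < ⟪x, z⟫_ℝ := by
    have hsq : ‖z - (m₁)‖ ^ 2 < (1 / 4) ^ 2 := by
      rw [norm_sub_sq_real, hz, hU1, real_inner_comm]; linarith
    have hclose : ‖z - (m₁)‖ < 1 / 4 := lt_of_pow_lt_pow_left₀ 2 (by norm_num) hsq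
    intro x hx
    have h := abs_real_inner_le_norm x (z - (m₁))
    rw [hx, one_mul, inner_sub_right] at h
    have := (abs_le.1 h).1
    linarith
  -- if `v` itself climbs we are done
  by_cases hvz : (1 / 32 : ℝ) ≤ ⟪v, z⟫_ℝ
  · exact ⟨v, hv, hvz, by linarith⟩
  push Not at hvz
  rcases hv with hv | hv | hv | hv | hv | hv | hv | hv | hv | hv | hv | hv <;> subst v
  · -- v = ℓ₁: the four available neighbours of u: m₂, m₃, ℓ₁ - ℓ₂, ℓ₁ - ℓ₃
    have z2 : 1 / 4 < ⟪m₂, z⟫_ℝ := by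
      have hpu : ⟪m₂, m₁⟫_ℝ = 1 / 2 := by simp only [mx2, xm1, l11, l22, l33, p12, p13, p23, p21, p31, p32, n1, n2, n3, n1', n2', n3', nn]; linear_combination (0 : ℝ) * hr2
      have := near (m₂) nm2; rw [hpu] at this; linarith
    have z3 : 1 / 4 < ⟪m₃, z⟫_ℝ := by
      have hpu : ⟪m₃, m₁⟫_ℝ = 1 / 2 := by simp only [mx3, xm1, l11, l22, l33, p12, p13, p23, p21, p31, p32, n1, n2, n3, n1', n2', n3', nn]; linear_combination (0 : ℝ) * hr2
      have := near (m₃) nm3; rw [hpu] at this; linarith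
    have zh2 : 1 / 4 < ⟪ℓ₁ - ℓ₂, z⟫_ℝ := by
      have hpu : ⟪ℓ₁ - ℓ₂, m₁⟫_ℝ = 1 / 2 := by simp only [inner_sub_left, xm1, l11, l22, l33, p12, p13, p23, p21, p31, p32, n1, n2, n3, n1', n2', n3', nn]; linear_combination (0 : ℝ) * hr2
      have := near (ℓ₁ - ℓ₂) d12; rw [hpu] at this; linarith [isl ℓ₁ ℓ₂ z, isl ℓ₁ ℓ₃ z, isl ℓ₁ ℓ₂ q, isl ℓ₁ ℓ₃ q]
    have zh3 : 1 / 4 < ⟪ℓ₁ - ℓ₃, z⟫_ℝ := by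
      have hpu : ⟪ℓ₁ - ℓ₃, m₁⟫_ℝ = 1 / 2 := by simp only [inner_sub_left, xm1, l11, l22, l33, p12, p13, p23, p21, p31, p32, n1, n2, n3, n1', n2', n3', nn]; linear_combination (0 : ℝ) * hr2
      have := near (ℓ₁ - ℓ₃) d13; rw [hpu] at this; linarith [isl ℓ₁ ℓ₂ z, isl ℓ₁ ℓ₃ z, isl ℓ₁ ℓ₂ q, isl ℓ₁ ℓ₃ q]
    by_cases c2 : (1 / 32 : ℝ) ≤ ⟪m₂, q⟫_ℝ
    · exact ⟨m₂, (Or.inr (Or.inr (Or.inr (Or.inr (Or.inl rfl))))), by linarith [isl ℓ₁ ℓ₂ z, isl ℓ₁ ℓ₃ z, isl ℓ₁ ℓ₂ q, isl ℓ₁ ℓ₃ q], c2⟩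
    by_cases c3 : (1 / 32 : ℝ) ≤ ⟪m₃, q⟫_ℝ
    · exact ⟨m₃, (Or.inr (Or.inr (Or.inr (Or.inr (Or.inr (Or.inl rfl)))))), by linarith [isl ℓ₁ ℓ₂ z, isl ℓ₁ ℓ₃ z, isl ℓ₁ ℓ₂ q, isl ℓ₁ ℓ₃ q], c3⟩
    push Not at c2 c3
    have q1 := mx1 q
    have q2 := mx2 q
    have q3 := mx3 q
    have hs := sumx q
    have e2 : ⟪ℓ₁ - ℓ₂, q⟫_ℝ = ⟪ℓ₁, q⟫_ℝ - ⟪ℓ₂, q⟫_ℝ := inner_sub_left _ _ _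
    have e3 : ⟪ℓ₁ - ℓ₃, q⟫_ℝ = ⟪ℓ₁, q⟫_ℝ - ⟪ℓ₃, q⟫_ℝ := inner_sub_left _ _ _
    rcases le_or_gt ⟪ℓ₁ - ℓ₃, q⟫_ℝ ⟪ℓ₁ - ℓ₂, q⟫_ℝ with h | h
    · exact ⟨ℓ₁ - ℓ₂, (Or.inr (Or.inr (Or.inr (Or.inr (Or.inr (Or.inr (Or.inl rfl))))))), by linarith [isl ℓ₁ ℓ₂ z, isl ℓ₁ ℓ₃ z, isl ℓ₁ ℓ₂ q, isl ℓ₁ ℓ₃ q], by linarith [isl ℓ₁ ℓ₂ z, isl ℓ₁ ℓ₃ z, isl ℓ₁ ℓ₂ q, isl ℓ₁ ℓ₃ q]⟩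
    · exact ⟨ℓ₁ - ℓ₃, (Or.inr (Or.inr (Or.inr (Or.inr (Or.inr (Or.inr (Or.inr (Or.inr (Or.inl rfl))))))))), by linarith [isl ℓ₁ ℓ₂ z, isl ℓ₁ ℓ₃ z, isl ℓ₁ ℓ₂ q, isl ℓ₁ ℓ₃ q], by linarith [isl ℓ₁ ℓ₂ z, isl ℓ₁ ℓ₃ z, isl ℓ₁ ℓ₂ q, isl ℓ₁ ℓ₃ q]⟩
  · -- v = ℓ₂: the four available neighbours of u: m₂, m₃, ℓ₁ - ℓ₂, ℓ₁ - ℓ₃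
    have z2 : 1 / 4 < ⟪m₂, z⟫_ℝ := by
      have hpu : ⟪m₂, m₁⟫_ℝ = 1 / 2 := by simp only [mx2, xm1, l11, l22, l33, p12, p13, p23, p21, p31, p32, n1, n2, n3, n1', n2', n3', nn]; linear_combination (0 : ℝ) * hr2
      have := near (m₂) nm2; rw [hpu] at this; linarith
    have z3 : 1 / 4 < ⟪m₃, z⟫_ℝ := by
      have hpu : ⟪m₃, m₁⟫_ℝ = 1 / 2 := by simp only [mx3, xm1, l11, l22, l33, p12, p13, p23, p21, p31, p32, n1, n2, n3, n1', n2', n3', nn]; linear_combination (0 : ℝ) * hr2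
      have := near (m₃) nm3; rw [hpu] at this; linarith
    have zh2 : 1 / 4 < ⟪ℓ₁ - ℓ₂, z⟫_ℝ := by
      have hpu : ⟪ℓ₁ - ℓ₂, m₁⟫_ℝ = 1 / 2 := by simp only [inner_sub_left, xm1, l11, l22, l33, p12, p13, p23, p21, p31, p32, n1, n2, n3, n1', n2', n3', nn]; linear_combination (0 : ℝ) * hr2
      have := near (ℓ₁ - ℓ₂) d12; rw [hpu] at this; linarith [isl ℓ₁ ℓ₂ z, isl ℓ₁ ℓ₃ z, isl ℓ₁ ℓ₂ q, isl ℓ₁ ℓ₃ q]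
    have zh3 : 1 / 4 < ⟪ℓ₁ - ℓ₃, z⟫_ℝ := by
      have hpu : ⟪ℓ₁ - ℓ₃, m₁⟫_ℝ = 1 / 2 := by simp only [inner_sub_left, xm1, l11, l22, l33, p12, p13, p23, p21, p31, p32, n1, n2, n3, n1', n2', n3', nn]; linear_combination (0 : ℝ) * hr2
      have := near (ℓ₁ - ℓ₃) d13; rw [hpu] at this; linarith [isl ℓ₁ ℓ₂ z, isl ℓ₁ ℓ₃ z, isl ℓ₁ ℓ₂ q, isl ℓ₁ ℓ₃ q]
    by_cases c2 : (1 / 32 : ℝ) ≤ ⟪m₂, q⟫_ℝ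
    · exact ⟨m₂, (Or.inr (Or.inr (Or.inr (Or.inr (Or.inl rfl))))), by linarith [isl ℓ₁ ℓ₂ z, isl ℓ₁ ℓ₃ z, isl ℓ₁ ℓ₂ q, isl ℓ₁ ℓ₃ q], c2⟩
    by_cases c3 : (1 / 32 : ℝ) ≤ ⟪m₃, q⟫_ℝ
    · exact ⟨m₃, (Or.inr (Or.inr (Or.inr (Or.inr (Or.inr (Or.inl rfl)))))), by linarith [isl ℓ₁ ℓ₂ z, isl ℓ₁ ℓ₃ z, isl ℓ₁ ℓ₂ q, isl ℓ₁ ℓ₃ q], c3⟩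
    push Not at c2 c3
    have q1 := mx1 q
    have q2 := mx2 q
    have q3 := mx3 q
    have hs := sumx q
    have e2 : ⟪ℓ₁ - ℓ₂, q⟫_ℝ = ⟪ℓ₁, q⟫_ℝ - ⟪ℓ₂, q⟫_ℝ := inner_sub_left _ _ _
    have e3 : ⟪ℓ₁ - ℓ₃, q⟫_ℝ = ⟪ℓ₁, q⟫_ℝ - ⟪ℓ₃, q⟫_ℝ := inner_sub_left _ _ _
    rcases le_or_gt ⟪ℓ₁ - ℓ₃, q⟫_ℝ ⟪ℓ₁ - ℓ₂, q⟫_ℝ with h | h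
    · exact ⟨ℓ₁ - ℓ₂, (Or.inr (Or.inr (Or.inr (Or.inr (Or.inr (Or.inr (Or.inl rfl))))))), by linarith [isl ℓ₁ ℓ₂ z, isl ℓ₁ ℓ₃ z, isl ℓ₁ ℓ₂ q, isl ℓ₁ ℓ₃ q], by linarith [isl ℓ₁ ℓ₂ z, isl ℓ₁ ℓ₃ z, isl ℓ₁ ℓ₂ q, isl ℓ₁ ℓ₃ q]⟩
    · exact ⟨ℓ₁ - ℓ₃, (Or.inr (Or.inr (Or.inr (Or.inr (Or.inr (Or.inr (Or.inr (Or.inr (Or.inl rfl))))))))), by linarith [isl ℓ₁ ℓ₂ z, isl ℓ₁ ℓ₃ z, isl ℓ₁ ℓ₂ q, isl ℓ₁ ℓ₃ q], by linarith [isl ℓ₁ ℓ₂ z, isl ℓ₁ ℓ₃ z, isl ℓ₁ ℓ₂ q, isl ℓ₁ ℓ₃ q]⟩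
  · -- v = ℓ₃: the four available neighbours of u: m₂, m₃, ℓ₁ - ℓ₂, ℓ₁ - ℓ₃
    have z2 : 1 / 4 < ⟪m₂, z⟫_ℝ := by
      have hpu : ⟪m₂, m₁⟫_ℝ = 1 / 2 := by simp only [mx2, xm1, l11, l22, l33, p12, p13, p23, p21, p31, p32, n1, n2, n3, n1', n2', n3', nn]; linear_combination (0 : ℝ) * hr2
      have := near (m₂) nm2; rw [hpu] at this; linarith
    have z3 : 1 / 4 < ⟪m₃, z⟫_ℝ := by
      have hpu : ⟪m₃, m₁⟫_ℝ = 1 / 2 := by simp only [mx3, xm1, l11, l22, l33, p12, p13, p23, p21, p31, p32, n1, n2, n3, n1', n2', n3', nn]; linear_combination (0 : ℝ) * hr2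
      have := near (m₃) nm3; rw [hpu] at this; linarith
    have zh2 : 1 / 4 < ⟪ℓ₁ - ℓ₂, z⟫_ℝ := by
      have hpu : ⟪ℓ₁ - ℓ₂, m₁⟫_ℝ = 1 / 2 := by simp only [inner_sub_left, xm1, l11, l22, l33, p12, p13, p23, p21, p31, p32, n1, n2, n3, n1', n2', n3', nn]; linear_combination (0 : ℝ) * hr2
      have := near (ℓ₁ - ℓ₂) d12; rw [hpu] at this; linarith [isl ℓ₁ ℓ₂ z, isl ℓ₁ ℓ₃ z, isl ℓ₁ ℓ₂ q, isl ℓ₁ ℓ₃ q]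
    have zh3 : 1 / 4 < ⟪ℓ₁ - ℓ₃, z⟫_ℝ := by
      have hpu : ⟪ℓ₁ - ℓ₃, m₁⟫_ℝ = 1 / 2 := by simp only [inner_sub_left, xm1, l11, l22, l33, p12, p13, p23, p21, p31, p32, n1, n2, n3, n1', n2', n3', nn]; linear_combination (0 : ℝ) * hr2
      have := near (ℓ₁ - ℓ₃) d13; rw [hpu] at this; linarith [isl ℓ₁ ℓ₂ z, isl ℓ₁ ℓ₃ z, isl ℓ₁ ℓ₂ q, isl ℓ₁ ℓ₃ q]
    by_cases c2 : (1 / 32 : ℝ) ≤ ⟪m₂, q⟫_ℝ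
    · exact ⟨m₂, (Or.inr (Or.inr (Or.inr (Or.inr (Or.inl rfl))))), by linarith [isl ℓ₁ ℓ₂ z, isl ℓ₁ ℓ₃ z, isl ℓ₁ ℓ₂ q, isl ℓ₁ ℓ₃ q], c2⟩
    by_cases c3 : (1 / 32 : ℝ) ≤ ⟪m₃, q⟫_ℝ
    · exact ⟨m₃, (Or.inr (Or.inr (Or.inr (Or.inr (Or.inr (Or.inl rfl)))))), by linarith [isl ℓ₁ ℓ₂ z, isl ℓ₁ ℓ₃ z, isl ℓ₁ ℓ₂ q, isl ℓ₁ ℓ₃ q], c3⟩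
    push Not at c2 c3
    have q1 := mx1 q
    have q2 := mx2 q
    have q3 := mx3 q
    have hs := sumx q
    have e2 : ⟪ℓ₁ - ℓ₂, q⟫_ℝ = ⟪ℓ₁, q⟫_ℝ - ⟪ℓ₂, q⟫_ℝ := inner_sub_left _ _ _
    have e3 : ⟪ℓ₁ - ℓ₃, q⟫_ℝ = ⟪ℓ₁, q⟫_ℝ - ⟪ℓ₃, q⟫_ℝ := inner_sub_left _ _ _
    rcases le_or_gt ⟪ℓ₁ - ℓ₃, q⟫_ℝ ⟪ℓ₁ - ℓ₂, q⟫_ℝ with h | h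
    · exact ⟨ℓ₁ - ℓ₂, (Or.inr (Or.inr (Or.inr (Or.inr (Or.inr (Or.inr (Or.inl rfl))))))), by linarith [isl ℓ₁ ℓ₂ z, isl ℓ₁ ℓ₃ z, isl ℓ₁ ℓ₂ q, isl ℓ₁ ℓ₃ q], by linarith [isl ℓ₁ ℓ₂ z, isl ℓ₁ ℓ₃ z, isl ℓ₁ ℓ₂ q, isl ℓ₁ ℓ₃ q]⟩
    · exact ⟨ℓ₁ - ℓ₃, (Or.inr (Or.inr (Or.inr (Or.inr (Or.inr (Or.inr (Or.inr (Or.inr (Or.inl rfl))))))))), by linarith [isl ℓ₁ ℓ₂ z, isl ℓ₁ ℓ₃ z, isl ℓ₁ ℓ₂ q, isl ℓ₁ ℓ₃ q], by linarith [isl ℓ₁ ℓ₂ z, isl ℓ₁ ℓ₃ z, isl ℓ₁ ℓ₂ q, isl ℓ₁ ℓ₃ q]⟩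
  · -- v = m₁: ⟪v,u⟫ = 1 ⇒ v climbs, contradiction
    exfalso
    have hγ : ⟪m₁, m₁⟫_ℝ = 1 := by simp only [mx1, xm1, l11, l22, l33, p12, p13, p23, p21, p31, p32, n1, n2, n3, n1', n2', n3', nn]; linear_combination (0 : ℝ) * hr2
    have := near (m₁) nm1
    rw [hγ] at this
    linarith
  · -- v = m₂: ⟪v,u⟫ = 1 / 2 ⇒ v climbs, contradiction
    exfalso
    have hγ : ⟪m₂, m₁⟫_ℝ = 1 / 2 := by simp only [mx2, xm1, l11, l22, l33, p12, p13, p23, p21, p31, p32, n1, n2, n3, n1', n2', n3', nn]; linear_combination (0 : ℝ) * hr2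
    have := near (m₂) nm2
    rw [hγ] at this
    linarith
  · -- v = m₃: ⟪v,u⟫ = 1 / 2 ⇒ v climbs, contradiction
    exfalso
    have hγ : ⟪m₃, m₁⟫_ℝ = 1 / 2 := by simp only [mx3, xm1, l11, l22, l33, p12, p13, p23, p21, p31, p32, n1, n2, n3, n1', n2', n3', nn]; linear_combination (0 : ℝ) * hr2
    have := near (m₃) nm3
    rw [hγ] at this
    linarith
  · -- v = ℓ₁ - ℓ₂: ⟪v,u⟫ = 1 / 2 ⇒ v climbs, contradiction
    exfalso
    have hγ : ⟪ℓ₁ - ℓ₂, m₁⟫_ℝ = 1 / 2 := by simp only [inner_sub_left, xm1, l11, l22, l33, p12, p13, p23, p21, p31, p32, n1, n2, n3, n1', n2', n3', nn]; linear_combination (0 : ℝ) * hr2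
    have := near (ℓ₁ - ℓ₂) d12
    rw [hγ] at this
    linarith [isl ℓ₁ ℓ₂ z, isl ℓ₁ ℓ₂ q]
  · -- v = ℓ₂ - ℓ₁: ⟪v,u⟫ = −1/2, take d = u + v = m₂
    have hγ : ⟪ℓ₂ - ℓ₁, m₁⟫_ℝ = -(1 / 2) := by simp only [inner_sub_left, xm1, l11, l22, l33, p12, p13, p23, p21, p31, p32, n1, n2, n3, n1', n2', n3', nn]; linear_combination (0 : ℝ) * hr2
    have hvz' := near (ℓ₂ - ℓ₁) d21
    rw [hγ] at hvz'
    have e : ∀ x, ⟪m₂, x⟫_ℝ = ⟪m₁, x⟫_ℝ + ⟪ℓ₂ - ℓ₁, x⟫_ℝ := fun x => by simp only [inner_sub_left, mx2, mx1]; ring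
    have ez := e z
    have eq' := e q
    exact ⟨m₂, (Or.inr (Or.inr (Or.inr (Or.inr (Or.inl rfl))))), by linarith [isl ℓ₂ ℓ₁ z, isl ℓ₂ ℓ₁ q], by linarith [isl ℓ₂ ℓ₁ z, isl ℓ₂ ℓ₁ q]⟩
  · -- v = ℓ₁ - ℓ₃: ⟪v,u⟫ = 1 / 2 ⇒ v climbs, contradiction
    exfalso
    have hγ : ⟪ℓ₁ - ℓ₃, m₁⟫_ℝ = 1 / 2 := by simp only [inner_sub_left, xm1, l11, l22, l33, p12, p13, p23, p21, p31, p32, n1, n2, n3, n1', n2', n3', nn]; linear_combination (0 : ℝ) * hr2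
    have := near (ℓ₁ - ℓ₃) d13
    rw [hγ] at this
    linarith [isl ℓ₁ ℓ₃ z, isl ℓ₁ ℓ₃ q]
  · -- v = ℓ₃ - ℓ₁: ⟪v,u⟫ = −1/2, take d = u + v = m₃
    have hγ : ⟪ℓ₃ - ℓ₁, m₁⟫_ℝ = -(1 / 2) := by simp only [inner_sub_left, xm1, l11, l22, l33, p12, p13, p23, p21, p31, p32, n1, n2, n3, n1', n2', n3', nn]; linear_combination (0 : ℝ) * hr2
    have hvz' := near (ℓ₃ - ℓ₁) d31
    rw [hγ] at hvz'
    have e : ∀ x, ⟪m₃, x⟫_ℝ = ⟪m₁, x⟫_ℝ + ⟪ℓ₃ - ℓ₁, x⟫_ℝ := fun x => by simp only [inner_sub_left, mx3, mx1]; ring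
    have ez := e z
    have eq' := e q
    exact ⟨m₃, (Or.inr (Or.inr (Or.inr (Or.inr (Or.inr (Or.inl rfl)))))), by linarith [isl ℓ₃ ℓ₁ z, isl ℓ₃ ℓ₁ q], by linarith [isl ℓ₃ ℓ₁ z, isl ℓ₃ ℓ₁ q]⟩
  · -- v = ℓ₂ - ℓ₃: ⟪v,u⟫ = 0, common neighbours m₂ and ℓ₁ - ℓ₃
    have hpz : 1 / 4 < ⟪m₂, z⟫_ℝ := by
      have hpu : ⟪m₂, m₁⟫_ℝ = 1 / 2 := by simp only [mx2, xm1, l11, l22, l33, p12, p13, p23, p21, p31, p32, n1, n2, n3, n1', n2', n3', nn]; linear_combination (0 : ℝ) * hr2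
      have := near (m₂) nm2; rw [hpu] at this; linarith [isl ℓ₂ ℓ₃ z, isl ℓ₂ ℓ₃ q, isl ℓ₁ ℓ₃ z, isl ℓ₁ ℓ₃ q]
    have hp'z : 1 / 4 < ⟪ℓ₁ - ℓ₃, z⟫_ℝ := by
      have hpu : ⟪ℓ₁ - ℓ₃, m₁⟫_ℝ = 1 / 2 := by simp only [inner_sub_left, xm1, l11, l22, l33, p12, p13, p23, p21, p31, p32, n1, n2, n3, n1', n2', n3', nn]; linear_combination (0 : ℝ) * hr2
      have := near (ℓ₁ - ℓ₃) d13; rw [hpu] at this; linarith [isl ℓ₂ ℓ₃ z, isl ℓ₂ ℓ₃ q, isl ℓ₁ ℓ₃ z, isl ℓ₁ ℓ₃ q]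
    have hs : ⟪m₂, q⟫_ℝ + ⟪ℓ₁ - ℓ₃, q⟫_ℝ = ⟪m₁, q⟫_ℝ + ⟪ℓ₂ - ℓ₃, q⟫_ℝ := by simp only [inner_sub_left, mx2, mx1]; ring
    rcases le_or_gt (Real.sqrt 2 / 4) ⟪m₂, q⟫_ℝ with h | h
    · exact ⟨m₂, (Or.inr (Or.inr (Or.inr (Or.inr (Or.inl rfl))))), by linarith [isl ℓ₂ ℓ₃ z, isl ℓ₂ ℓ₃ q, isl ℓ₁ ℓ₃ z, isl ℓ₁ ℓ₃ q], by linarith [isl ℓ₂ ℓ₃ z, isl ℓ₂ ℓ₃ q, isl ℓ₁ ℓ₃ z, isl ℓ₁ ℓ₃ q]⟩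
    · exact ⟨ℓ₁ - ℓ₃, (Or.inr (Or.inr (Or.inr (Or.inr (Or.inr (Or.inr (Or.inr (Or.inr (Or.inl rfl))))))))), by linarith [isl ℓ₂ ℓ₃ z, isl ℓ₂ ℓ₃ q, isl ℓ₁ ℓ₃ z, isl ℓ₁ ℓ₃ q], by linarith [isl ℓ₂ ℓ₃ z, isl ℓ₂ ℓ₃ q, isl ℓ₁ ℓ₃ z, isl ℓ₁ ℓ₃ q]⟩
  · -- v = ℓ₃ - ℓ₂: ⟪v,u⟫ = 0, common neighbours m₃ and ℓ₁ - ℓ₂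
    have hpz : 1 / 4 < ⟪m₃, z⟫_ℝ := by
      have hpu : ⟪m₃, m₁⟫_ℝ = 1 / 2 := by simp only [mx3, xm1, l11, l22, l33, p12, p13, p23, p21, p31, p32, n1, n2, n3, n1', n2', n3', nn]; linear_combination (0 : ℝ) * hr2
      have := near (m₃) nm3; rw [hpu] at this; linarith [isl ℓ₃ ℓ₂ z, isl ℓ₃ ℓ₂ q, isl ℓ₁ ℓ₂ z, isl ℓ₁ ℓ₂ q]
    have hp'z : 1 / 4 < ⟪ℓ₁ - ℓ₂, z⟫_ℝ := by
      have hpu : ⟪ℓ₁ - ℓ₂, m₁⟫_ℝ = 1 / 2 := by simp only [inner_sub_left, xm1, l11, l22, l33, p12, p13, p23, p21, p31, p32, n1, n2, n3, n1', n2', n3', nn]; linear_combination (0 : ℝ) * hr2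
      have := near (ℓ₁ - ℓ₂) d12; rw [hpu] at this; linarith [isl ℓ₃ ℓ₂ z, isl ℓ₃ ℓ₂ q, isl ℓ₁ ℓ₂ z, isl ℓ₁ ℓ₂ q]
    have hs : ⟪m₃, q⟫_ℝ + ⟪ℓ₁ - ℓ₂, q⟫_ℝ = ⟪m₁, q⟫_ℝ + ⟪ℓ₃ - ℓ₂, q⟫_ℝ := by simp only [inner_sub_left, mx3, mx1]; ring
    rcases le_or_gt (Real.sqrt 2 / 4) ⟪m₃, q⟫_ℝ with h | h
    · exact ⟨m₃, (Or.inr (Or.inr (Or.inr (Or.inr (Or.inr (Or.inl rfl)))))), by linarith [isl ℓ₃ ℓ₂ z, isl ℓ₃ ℓ₂ q, isl ℓ₁ ℓ₂ z, isl ℓ₁ ℓ₂ q], by linarith [isl ℓ₃ ℓ₂ z, isl ℓ₃ ℓ₂ q, isl ℓ₁ ℓ₂ z, isl ℓ₁ ℓ₂ q]⟩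
    · exact ⟨ℓ₁ - ℓ₂, (Or.inr (Or.inr (Or.inr (Or.inr (Or.inr (Or.inr (Or.inl rfl))))))), by linarith [isl ℓ₃ ℓ₂ z, isl ℓ₃ ℓ₂ q, isl ℓ₁ ℓ₂ z, isl ℓ₁ ℓ₂ q], by linarith [isl ℓ₃ ℓ₂ z, isl ℓ₃ ℓ₂ q, isl ℓ₁ ℓ₂ z, isl ℓ₁ ℓ₂ q]⟩

end Summit.Ventures.Crystal3D.Theorems

end

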